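import Summits.AtomisticToContinuum.HydrodynamicLimit.Theorems.EquilibriumClampedCollisionalWindowLD.Negative.PulseTransfer

/-!
# Newton-cradle pulse, part 3: block constants and the recursive certificate (helper file, refutation of `EquilibriumClampedCollisionalWindowLD`, stmt-AtomisticToContinuum-13733, layer L3; see `Cruxes/EquilibriumClampedCollisionalWindowLD/Disproof.lean`, evidence WITNESS.md §4.3; no Theses declaration is asserted; refuter-cdisprove-stmt-AtomisticToContinuum-13733-0)

`Params`, `Params.Admissible` (the finitely many inequalities used, discharged asymptotically in the refutation), `BlockData`, `carrier`/`tHit`/`pos`/`vel`.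
-/

noncomputable section

open Real
open scoped InnerProductSpace

namespace Summit.AtomisticToContinuum.HydrodynamicLimit.Theorems

namespace EquilibriumClampedCollisionalWindowLDNegative

/-! ## The cradle block: parameters, recursion, invariant -/

/-- Parameters of one cradle block: slot spacing `s`, diameter `ε`, pulse speed `V`, position
tolerance `r` (bound on `‖ξ k‖`), velocity tolerance `u` (bound on `‖η k‖`, `k ≥ 1`, and on
`‖η 0 - V e‖`), a time horizon `Tmax`, the direction-error allowance `αs`, and the number `K` of
slots whose data are controlled. -/
structure Params where
  s : ℝ
  ε : ℝ
  V : ℝ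
  r : ℝ
  u : ℝ
  Tmax : ℝ
  αs : ℝ
  K : ℕ

namespace Params

variable (P : Params)

/-- gap `s - ε` -/
def g : ℝ := P.s - P.ε
/-- bound on the relative-position perturbation `Δ_k` -/
def δs : ℝ := 2 * P.r + 2 * P.Tmax * P.u
/-- bound on the direction error of the relative velocity -/
def αp : ℝ := P.αs + 4 * P.u / P.V
/-- bound on the miss distance `p` -/
def ps : ℝ := P.s * P.αp + P.δs
/-- timing noise -/
def νs : ℝ := P.δs + P.ps ^ 2 / P.ε
/-- per-transfer speed change allowance -/
def dV : ℝ := 2 * P.u + 2 * P.V * (P.ps ^ 2 / P.ε ^ 2)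
/-- lower / upper bounds on all speeds involved -/
def Vlo : ℝ := P.V - 2 * P.u - P.K * P.dV
/-- upper bound on all speeds involved [folklore] -/
def Vhi : ℝ := P.V + 2 * P.u + P.K * P.dV
/-- bounds on one transfer time -/
def θlo : ℝ := (P.g - P.νs) / P.Vhi
/-- upper bound on one transfer time [folklore] -/
def θhi : ℝ := (P.g + P.νs) / P.Vlo
/-- bound on the direction error of a contact normal -/
def αn : ℝ := (P.g * P.αp + 2 * P.δs + P.ps ^ 2 / P.ε) / P.ε
/-- lower bound on a normal impulse -/
def clo : ℝ := P.Vlo * (1 - P.ps ^ 2 / P.ε ^ 2)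
/-- bound on residual (spent) speeds -/
def ρs : ℝ := 2 * P.Vhi * P.ps / P.ε + P.u

/-- The finitely many inequalities between the constants under which the block analysis runs
(discharged asymptotically in the refutation). -/
structure Admissible : Prop where
  ε_pos : 0 < P.ε
  ε_lt_s : P.ε < P.s
  s_le : P.s ≤ 2 * P.ε
  V_pos : 0 < P.V
  r_nn : 0 ≤ P.r
  u_nn : 0 ≤ P.u
  T_nn : 0 ≤ P.Tmax
  αs_nn : 0 ≤ P.αs
  small : P.s * P.αp + P.δs ≤ P.g / 4
  Vlo_ge : P.V / 2 ≤ P.Vlo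
  Vhi_le : P.Vhi ≤ 2 * P.V
  u_le : 8 * P.u ≤ P.V
  ps_le : P.ps ≤ P.ε / 2
  α_closes : P.αn + 2 * P.u / (P.clo - P.u) ≤ P.αs
  T_ge : P.K * P.θhi ≤ P.Tmax
  νs_lt : P.νs < P.g

namespace Admissible

variable {P} (h : P.Admissible)
include h

/-- The gap is positive. [folklore] -/
theorem g_pos : 0 < P.g := sub_pos.2 h.ε_lt_s
/-- The gap is at most the diameter. [folklore] -/
theorem g_le_ε : P.g ≤ P.ε := by have := h.s_le; unfold g; linarith
/-- The slot spacing is positive. [folklore] -/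
theorem s_pos : 0 < P.s := h.ε_pos.trans h.ε_lt_s
/-- `δs ≥ 0`. [folklore] -/
theorem δs_nn : 0 ≤ P.δs := by
  have := h.r_nn; have := h.u_nn; have := h.T_nn; unfold δs; positivity
/-- `αs ≤ αp`. [folklore] -/
theorem αp_ge : P.αs ≤ P.αp := by
  have := h.u_nn; have := h.V_pos; unfold αp
  have : 0 ≤ 4 * P.u / P.V := by positivity
  linarith
/-- `αp ≥ 0`. [folklore] -/
theorem αp_nn : 0 ≤ P.αp := h.αs_nn.trans h.αp_ge
/-- `ps ≥ 0`. [folklore] -/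
theorem ps_nn : 0 ≤ P.ps := by
  have := h.αp_nn; have := h.δs_nn; have := h.s_pos; unfold ps; positivity
/-- The squared relative miss distance is at most `1/4`. [folklore] -/
theorem x_le : P.ps ^ 2 / P.ε ^ 2 ≤ 1 / 4 := by
  have h1 := h.ps_le; have h2 := h.ps_nn; have h3 := h.ε_pos
  rw [div_le_iff₀ (by positivity)]
  nlinarith
/-- `νs ≥ 0`. [folklore] -/
theorem νs_nn : 0 ≤ P.νs := by
  have := h.δs_nn; have := h.ε_pos; unfold νs; positivity
/-- `dV ≥ 0`. [folklore] -/
theorem dV_nn : 0 ≤ P.dV := by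
  have := h.u_nn; have := h.V_pos; unfold dV; positivity
/-- `Vlo > 0`. [folklore] -/
theorem Vlo_pos : 0 < P.Vlo := lt_of_lt_of_le (by linarith [h.V_pos]) h.Vlo_ge
/-- `Vlo ≤ Vhi`. [folklore] -/
theorem Vlo_le_Vhi : P.Vlo ≤ P.Vhi := by
  have := h.u_nn; have := h.dV_nn; unfold Vlo Vhi
  have : (0 : ℝ) ≤ P.K * P.dV := by positivity
  linarith
/-- `Vhi > 0`. [folklore] -/
theorem Vhi_pos : 0 < P.Vhi := h.Vlo_pos.trans_le h.Vlo_le_Vhi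
/-- `θlo > 0`. [folklore] -/
theorem θlo_pos : 0 < P.θlo := div_pos (sub_pos.2 h.νs_lt) h.Vhi_pos
/-- `θlo ≤ θhi`. [folklore] -/
theorem θlo_le_θhi : P.θlo ≤ P.θhi := by
  unfold θlo θhi
  have h1 := h.νs_nn; have h2 := h.Vlo_pos; have h3 := h.Vlo_le_Vhi; have h4 := h.νs_lt
  calc (P.g - P.νs) / P.Vhi ≤ (P.g - P.νs) / P.Vlo :=
        div_le_div_of_nonneg_left (by linarith) h2 h3
    _ ≤ (P.g + P.νs) / P.Vlo := div_le_div_of_nonneg_right (by linarith) h2.le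
/-- `θhi > 0`. [folklore] -/
theorem θhi_pos : 0 < P.θhi := h.θlo_pos.trans_le h.θlo_le_θhi
/-- `clo > 0`. [folklore] -/
theorem clo_pos : 0 < P.clo := by
  unfold clo; have := h.x_le; exact mul_pos h.Vlo_pos (by linarith)
/-- `clo ≥ 3V/8`. [folklore] -/
theorem clo_ge : 3 / 8 * P.V ≤ P.clo := by
  unfold clo; have h1 := h.x_le; have h2 := h.Vlo_ge; have h3 := h.V_pos
  nlinarith
/-- The velocity tolerance is below every impulse. [folklore] -/
theorem u_lt_clo : P.u < P.clo := by
  have := h.clo_ge; have := h.u_le; have := h.V_pos; linarith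
/-- `clo ≤ Vlo`. [folklore] -/
theorem clo_le_Vlo : P.clo ≤ P.Vlo := by
  unfold clo; have : 0 ≤ P.ps ^ 2 / P.ε ^ 2 := by positivity
  have := h.Vlo_pos; nlinarith
/-- `αn ≥ 0`. [folklore] -/
theorem αn_nn : 0 ≤ P.αn := by
  have := h.g_pos; have := h.αp_nn; have := h.δs_nn; have := h.ε_pos; unfold αn; positivity
/-- The direction kick of a target velocity fits in the allowance. [folklore] -/
theorem two_u_div_le_αs : 2 * P.u / (P.clo - P.u) ≤ P.αs := by
  have := h.α_closes; have := h.αn_nn; linarith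
/-- `ρs ≥ 0`. [folklore] -/
theorem ρs_nn : 0 ≤ P.ρs := by
  have := h.Vhi_pos; have := h.ps_nn; have := h.ε_pos; have := h.u_nn; unfold ρs; positivity

end Admissible

end Params

section BlockAll

variable {E : Type*} [NormedAddCommGroup E] [InnerProductSpace ℝ E]

/-- Data of one cradle block: position perturbations `ξ k` of the slots `k s e` and velocities
`η k` (`η 0` is the FULL driver velocity, `η k`, `k ≥ 1`, are the small velocities of the relay
spheres). -/
structure BlockData (E : Type*) where
  ξ : ℕ → E
  η : ℕ → E

/-- State of the current carrier: launch time, launch position, velocity. -/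
structure CState (E : Type*) where
  t : ℝ
  p : E
  W : E

section BlockDefs

variable (P : Params) (e : E) (D : BlockData E)

/-- position of the sphere of slot `k` at time `0` -/
def base (k : ℕ) : E := ((k : ℝ) * P.s) • e + D.ξ k

/-- relative position of the target `k+1` w.r.t. the carrier at the carrier's launch time -/
def relPos (k : ℕ) (c : CState E) : E := base P e D (k + 1) + c.t • D.η (k + 1) - c.p

/-- relative velocity carrier minus target -/
def relVel (k : ℕ) (c : CState E) : E := c.W - D.η (k + 1)

/-- duration of the flight of the carrier `k` -/
def stepθ (k : ℕ) (c : CState E) : ℝ := hitTime (relPos P e D k c) (relVel D k c) P.ε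

/-- contact normal (from carrier to target) of the transfer `k → k+1` -/
def stepNormal (k : ℕ) (c : CState E) : E :=
  P.ε⁻¹ • (relPos P e D k c - stepθ P e D k c • relVel D k c)

/-- normal impulse of the transfer `k → k+1` -/
def stepImp (k : ℕ) (c : CState E) : ℝ := ⟪relVel D k c, stepNormal P e D k c⟫_ℝ

/-- the next carrier -/
def step (k : ℕ) (c : CState E) : CState E :=
  ⟨c.t + stepθ P e D k c, base P e D (k + 1) + (c.t + stepθ P e D k c) • D.η (k + 1),
    D.η (k + 1) + stepImp P e D k c • stepNormal P e D k c⟩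

/-- the sequence of carriers of the pulse -/
def carrier : ℕ → CState E
  | 0 => ⟨0, D.ξ 0, D.η 0⟩
  | k + 1 => step P e D k (carrier k)

/-- time at which the sphere of slot `k` is hit (launch time of carrier `k`; `0` for the driver) -/
def tHit (k : ℕ) : ℝ := (carrier P e D k).t
/-- flight duration, contact normal, impulse of the transfer `k → k+1` -/
def θk (k : ℕ) : ℝ := stepθ P e D k (carrier P e D k)
/-- contact normal of the transfer `k → k+1` [folklore] -/
def nk (k : ℕ) : E := stepNormal P e D k (carrier P e D k)
/-- normal impulse of the transfer `k → k+1` [folklore] -/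
def ck (k : ℕ) : ℝ := stepImp P e D k (carrier P e D k)
/-- residual velocity and stopping position of the spent sphere `k` -/
def ρk (k : ℕ) : E := (carrier P e D k).W - ck P e D k • nk P e D k
/-- stopping position of the spent sphere `k` [folklore] -/
def qk (k : ℕ) : E := (carrier P e D k).p + θk P e D k • (carrier P e D k).W

/-- the certified trajectory of the sphere of slot `k` (lifted positions) -/
def pos (k : ℕ) (t : ℝ) : E :=
  if t < tHit P e D k then base P e D k + t • D.η k
  else if t < tHit P e D (k + 1) then
    (carrier P e D k).p + (t - tHit P e D k) • (carrier P e D k).W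
  else qk P e D k + (t - tHit P e D (k + 1)) • ρk P e D k

/-- the certified velocity of the sphere of slot `k` -/
def vel (k : ℕ) (t : ℝ) : E :=
  if t < tHit P e D k then D.η k
  else if t < tHit P e D (k + 1) then (carrier P e D k).W
  else ρk P e D k

/-- The driver starts at time `0`. [folklore] -/
@[simp] theorem tHit_zero : tHit P e D 0 = 0 := rfl
/-- Hit times accumulate the flight durations. [folklore] -/
theorem tHit_succ (k : ℕ) : tHit P e D (k + 1) = tHit P e D k + θk P e D k := rfl
/-- The velocity of the new carrier. [folklore] -/
theorem carrier_succ_W (k : ℕ) :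
    (carrier P e D (k + 1)).W = D.η (k + 1) + ck P e D k • nk P e D k := rfl
/-- The launch position of the new carrier. [folklore] -/
theorem carrier_succ_p (k : ℕ) :
    (carrier P e D (k + 1)).p = base P e D (k + 1) + tHit P e D (k + 1) • D.η (k + 1) := rfl
/-- The driver starts at its slot perturbation. [folklore] -/
@[simp] theorem carrier_zero_p : (carrier P e D 0).p = D.ξ 0 := rfl
/-- The driver starts with its full velocity. [folklore] -/
@[simp] theorem carrier_zero_W : (carrier P e D 0).W = D.η 0 := rfl

end BlockDefs


end BlockAll

end EquilibriumClampedCollisionalWindowLDNegative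

end Summit.AtomisticToContinuum.HydrodynamicLimit.Theorems

end
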